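import Summits.BirchSwinnertonDyer.Rank1Residual.Additive.X4RankZeroVisibleLowerBound
import Summits.BirchSwinnertonDyer.Rank1Residual.GaloisImage.CongruenceVisibilityPotMult
import Literature.NumberTheory.EllipticCurves.CongruentNumberCurveSupersingular
import Literature.NumberTheory.EllipticCurves.SelmerCorankControlRatProofs
import HarnessLib

/-!
# X4 ∧ `r = 0`: the visibility ENDs in KIND-AGNOSTIC form, and the T-VIS3-TATE record socket over
# `…_of_places₆` in prime-list form (cell `b2b-bsdres`, team n1011; ROW T-VIS3-TATE records,
# lead R5-87 (n) "records recipe handed to p17 / p18 / p14 / p07 / p03 lineages"; seat p14 GEN 5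
# under the idle rule R3-25 (f) after the session cap of the standing row T-VIS3-REC-E; TOOL file)

HONEST FRAMING (cell `b2b-bsdres`, run/shared/lean/b2b/bsd-rank1-residual/, verbatim in every
file): the goal of the cell is to DELETE the COMBINATION-SHAPED residual classes of the
Birch–Swinnerton-Dyer formula for ALL analytic-rank `≤ 1` elliptic curves over `ℚ` — "full BSD
formula for every rank `≤ 1` curve in class `C`" assembled STRICTLY from published theorems — so
that the rank-`≤ 1` remainder becomes exactly the CONSTRUCTION-SHAPED classes, which are TYPED
(missing-input `Prop`s), NOT attempted. This is not "finishing BSD". Team n1011 (N11 = X4 ∧ `p = 3`):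
research route on the CONSTRUCTION-SHAPED class X4; TOOL theorems only (no definition, no new named
fact, no `sorry`); CONDITIONAL on the named facts displayed as hypotheses (the seven UPPER-half facts
of n1011-p03's (M)-END, A40/A41 = Tate uniformisation `hU`/`hU2`, A24 = Cassels–Tate `hCT`); closes
NO class and NO row by itself; nothing booked; no mark / label / count moved.

## Why

Every visibility road of the cell ends in the same two compositions — n1011-p03's
`X4RankZero.bsdp_three_potMult_of_congr_of_rank_two` ((M) rows: visible `Ш[3]` element ⟹
`Sel^(3)(E/ℚ) ≠ ⊥` ⟹ additive-p1's `…_of_selmerGroup_ne_bot_noL20`) and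
`X4RankZero.bsdp_of_congr_of_rank_two_of_kato` (potentially good rows: visible element ⟹ `3 ∣ #Ш` ⟹
Cassels–Tate ⟹ Kato) — but each road re-derives them for ITS certificate shape (`…_of_rank`,
`…_of_primeList` p307030, `…_of_witnessChecks` ×2 p17 D6, and pending `…_of_places₄/₅` (T-NSK-REC),
`…_of_places₆` (T-VIS3-TATE), kind (vii) (T-2LL), T-VIS3-UC).  §1 states the two ENDs ONCE with the
visible element `hvis : ∃ c : Ш(E), c ≠ 0 ∧ p • c = 0` as the input, so that any present or future
certificate theorem `…exists_sha_ne_zero…` feeds them by name.  §2 is the prime-list plumbing of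
p307030 as two stand-alone lemmas (the finite set of places over a list of rational primes; good
reduction of both integer models off it).  §3 is the record socket the T-VIS3-TATE rows need
(r1 ROUTE-1 §42 / ST-42a, road PASS-T: the N11 row `E` and its `3`-congruent partner `E′` are BOTH
additive potentially multiplicative at `3` — kind (iii′) of n1011-p09's
`TwistedKummer.exists_sha_ne_zero_of_congr_of_places₆` (p311741) at the place `3`, every other place
of `S` one of the six kinds, NO paid place, budget `1 < 3^{rank E′}`): the (M)-END over `…_of_places₆`
with `S` = the places over a prime list `L ∋ 3` supporting both discriminants, `T = ∅`.

References: [CremonaMazur2000] §3 and Table 1; [AgasheStein2002] Thm. 3.1, §3.5; [Kato2004Asterisque]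
Thm. 14.5 (3); [Delbourgo1998] Prop. 4; [SilvermanAEC2009] VII.5.1 (a), X.4.2 (a), X.4.14;
[SilvermanATAEC1994] V.3.1, V.5.2, V.5.3, V.5.4; [Miller2011LMS] Def. 1.1.
-/

set_option autoImplicit false

noncomputable section

open scoped Classical NumberField
open IsDedekindDomain NumberField WeierstrassCurve Rat.HeightOneSpectrum
  Literature.NumberTheory.EllipticCurves Literature.NumberTheory.EllipticCurves.ModularForms
  Literature.NumberTheory.EllipticCurves.Rank1Residual
  Literature.NumberTheory.EllipticCurves.Rank1Residual.Typed
  Literature.NumberTheory.GaloisRepresentations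
  Summit.BirchSwinnertonDyer.Rank1Residual.GaloisImage

namespace Summit.BirchSwinnertonDyer.Rank1Residual.Additive

/-! ### §1. The two N11 visibility ENDs with the visible element as the input -/

/-- **X4 ∧ `r = 0`, potentially MULTIPLICATIVE at `3`, `ρ̄_{E,3}` onto, `ord₃ #Ш_an ≤ 2`: `BSD(E,3)`
from ANY visible element of `Ш(E)[3]`** (kind-agnostic form of n1011-p03's
`X4RankZero.bsdp_three_potMult_of_congr_of_rank_two`): `Sel^(3)(E/ℚ) ↠ Ш(E/ℚ)[3]`
(`exists_selmerToSha_eq`, Silverman X.4.2 (a)) makes `Sel^(3)(E/ℚ) ≠ ⊥`, and additive-p1's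
`X4RankZero.bsdp_three_potMult_of_selmerGroup_ne_bot_noL20` (Delbourgo (M) + Kato's half
eigen-ideal + Cassels–Tate) concludes. [cite: SilvermanAEC2009, Thm. X.4.2 (a)]
[cite: Delbourgo1998, Prop. 4 (p. 144)] -/
theorem X4RankZero.bsdp_three_potMult_of_exists_sha_three_torsion
    (hKatoS : Kato2004.rankZero_padicValNat_sha_le_sub_localTamagawa_of_additive_potGood_of_imageContainsSL2)
    (hDel : Delbourgo1998.prop4_rankZero_pow_dvd_constantCoeff)
    (hGZK : rank_eq_analyticRank_of_analyticRank_le_one) (hmod : hasEntireLFunction_rat)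
    (hmodD : nonempty_modularParametrizationData)
    (hKatoχ : Wuthrich2014.kato_halfEigenCharIdeal_dvd_cyclotomicPrime_of_surjective)
    (hCT : exists_casselsTate_pairing (K := ℚ))
    (W : WeierstrassCurve ℚ) [W.IsElliptic] [W.IsGloballyMinimal] (hr : W.analyticRank = 0)
    (hX : haveI : Fact (Nat.Prime 3) := ⟨Nat.prime_three⟩; ClassX4 W 3)
    (hsurj : W.HasSurjectiveModNGaloisRep 3) (hj : padicValRat 3 W.j < 0)
    {q : ℚ} (hq : shaAn W = (q : ℂ)) (hv : padicValRat 3 q ≤ 2)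
    (hvis : ∃ c : W.sha, c ≠ 0 ∧ (3 : ℕ) • c = 0) :
    haveI : Fact (Nat.Prime 3) := ⟨Nat.prime_three⟩
    BSDp W 3 := by
  haveI : Fact (Nat.Prime 3) := ⟨Nat.prime_three⟩
  obtain ⟨c, hc0, hc3⟩ := hvis
  -- `Sel^(3)(E/ℚ) ↠ Ш(E/ℚ)[3]`: a preimage of the visible class is a non-zero Selmer element
  obtain ⟨z, hz⟩ := exists_selmerToSha_eq W (n := ((3 : ℕ) : ℤ)) (by norm_num) c
    (by exact_mod_cast hc3)
  have hSel : W.selmerGroup ((3 : ℕ) : ℤ) ≠ ⊥ := by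
    intro hbot
    have hmem : (z : W.galH1Torsion ((3 : ℕ) : ℤ)) ∈ (⊥ : AddSubgroup _) := hbot ▸ z.2
    have hz0 : z = 0 := Subtype.ext ((AddSubgroup.mem_bot).mp hmem)
    exact hc0 (by rw [← hz, hz0, map_zero])
  exact X4RankZero.bsdp_three_potMult_of_selmerGroup_ne_bot_noL20 W hKatoS hDel hGZK hmod hmodD hKatoχ
    hCT hr hX hsurj hj hq hv hSel

/-- **X4 ∧ `r = 0`, potentially GOOD at an odd `p`, tower onto, `p ∤ ∏ c_ℓ`, a parametrisation datum
with `p ∤ c_D`, `ord_p #Ш_an ≤ 2`: `BSD(E,p)` from ANY visible element of `Ш(E)[p]`** (kind-agnostic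
form of n1011-p03's `X4RankZero.bsdp_of_congr_of_rank_two_of_kato`): `dvd_shaOrder_of_exists_torsion`
→ Cassels–Tate (`missingLowerBoundAt_of_casselsTate_of_pow_dvd`, `k = 1`) → additive-p1's
`X4RankZero.bsdp_of_missingLowerBoundAt_of_kato` (Kato 2004 Thm. 14.5 (3)).
[cite: Kato2004Asterisque, Thm. 14.5 (3) (p. 236)] [cite: SilvermanAEC2009, Thm. X.4.14] -/
theorem X4RankZero.bsdp_of_exists_sha_torsion_of_kato
    (hKato : Kato2004.rankZero_padicValNat_sha_le_of_additive_potGood_of_imageContainsSL2)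
    (hCT : exists_casselsTate_pairing (K := ℚ))
    (hGZK : rank_eq_analyticRank_of_analyticRank_le_one) (hmod : hasEntireLFunction_rat)
    (W : WeierstrassCurve ℚ) [W.IsElliptic] [W.IsGloballyMinimal] (p : ℕ) [Fact p.Prime]
    (hr : W.analyticRank = 0) (hX : ClassX4 W p) (hpot : 0 ≤ padicValRat p W.j)
    (hsurj : ∀ n : ℕ, W.HasSurjectiveModNGaloisRep (p ^ n : ℕ)) (htam : ¬ p ∣ W.tamagawaProduct)
    {N : ℕ} [NeZero N] (D : ModularParametrizationData W N) (hc : ¬ (p : ℤ) ∣ D.maninConstant)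
    {q : ℚ} (hq : shaAn W = (q : ℂ)) (hv : padicValRat p q ≤ 2)
    (hvis : ∃ c : W.sha, c ≠ 0 ∧ p • c = 0) :
    BSDp W p := by
  have hlow : MissingLowerBoundAt W p :=
    missingLowerBoundAt_of_casselsTate_of_pow_dvd W p hCT (hGZK W (by omega)).2 hq (k := 1)
      (by simpa using hv) (by simpa using dvd_shaOrder_of_exists_torsion W p hvis)
  exact X4RankZero.bsdp_of_missingLowerBoundAt_of_kato W p hKato hGZK hmod hr hX hpot hsurj htam D hc
    hlow

/-! ### §2. The places of `ℚ` over a list of rational primes -/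

/-- **The finite set of places of `ℚ` over a list `L` of natural numbers** (its members are exactly
the places `v` with `primesEquiv v ∈ L`; the non-primes of `L` contribute nothing) — the `S` of
p307030, as a stand-alone existence statement (no definition). [folklore] -/
theorem exists_placeFinset_of_primeList (L : List ℕ) :
    ∃ S : Finset (HeightOneSpectrum (𝓞 ℚ)),
      ∀ v : HeightOneSpectrum (𝓞 ℚ), v ∈ S ↔ (primesEquiv v : ℕ) ∈ L := by
  set e := primesEquiv (R := 𝓞 ℚ) with he
  refine ⟨(L.filterMap fun q ↦ if h : q.Prime then some (e.symm ⟨q, h⟩) else none).toFinset,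
    fun v ↦ ?_⟩
  rw [List.mem_toFinset, List.mem_filterMap]
  constructor
  · rintro ⟨q, hq, hqv⟩
    by_cases hqp : q.Prime
    · rw [dif_pos hqp, Option.some.injEq] at hqv
      rw [← hqv, Equiv.apply_symm_apply]
      exact hq
    · rw [dif_neg hqp] at hqv
      exact absurd hqv (by simp)
  · intro hv
    refine ⟨(e v : ℕ), hv, ?_⟩
    rw [dif_pos (e v).2]
    simp

/-- **Off the places over `L`, two integer models whose discriminants are supported on `L` both have
good reduction, and the place does not divide a prime `p ∈ L`** (Silverman VII.5.1 (a); the `hS` of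
p307030 as a stand-alone lemma). [cite: SilvermanAEC2009, VII.5 Prop. 5.1(a)] -/
theorem good_and_not_mem_of_not_mem_placeFinset {W W' : WeierstrassCurve ℚ}
    {E₀ F₀ : WeierstrassCurve ℤ} (hE : E₀.map (Int.castRingHom ℚ) = W)
    (hF : F₀.map (Int.castRingHom ℚ) = W') (L : List ℕ) {p : ℕ} (hp : p.Prime) (hpL : p ∈ L)
    (hΔE : ∀ q : ℕ, q.Prime → (q : ℤ) ∣ E₀.Δ → q ∈ L)
    (hΔF : ∀ q : ℕ, q.Prime → (q : ℤ) ∣ F₀.Δ → q ∈ L)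
    {S : Finset (HeightOneSpectrum (𝓞 ℚ))}
    (hS : ∀ v : HeightOneSpectrum (𝓞 ℚ), v ∈ S ↔ (primesEquiv v : ℕ) ∈ L) :
    ∀ v : HeightOneSpectrum (𝓞 ℚ), v ∉ S →
      W.HasGoodReductionAt v ∧ W'.HasGoodReductionAt v ∧ (p : 𝓞 ℚ) ∉ v.asIdeal := by
  intro v hvS
  have hvL : (primesEquiv v : ℕ) ∉ L := fun h ↦ hvS ((hS v).mpr h)
  have hqp : (primesEquiv v : ℕ).Prime := (primesEquiv v).2
  refine ⟨?_, ?_, fun hpv ↦ hvL ?_⟩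
  · rw [← hE]
    exact hasGoodReductionAt_map_of_not_dvd E₀ v fun h ↦ hvL (hΔE _ hqp h)
  · rw [← hF]
    exact hasGoodReductionAt_map_of_not_dvd F₀ v fun h ↦ hvL (hΔF _ hqp h)
  · rw [Rat.HeightOneSpectrum.primesEquiv_eq_of_natCast_mem v hp hpv]
    exact hpL

/-! ### §3. The T-VIS3-TATE record socket: (M) rows over `…_of_places₆`, `T = ∅`, prime-list form -/

/-- **T-VIS3-TATE record socket ((M) rows).** `BSD(E,3)` for an X4 ∧ `r_an = 0` row `E = W`,
potentially multiplicative at `3` (`ord₃ j < 0`), `ρ̄_{E,3}` onto, `ord₃ #Ш_an ≤ 2`, from a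
`3`-CONGRUENT partner `E′ = W′` of rank `≥ 1` whose local Kummer conditions agree with those of `E`
at EVERY place over a prime list `L ∋ 3` supporting both discriminants — each place of one of the six
kinds of n1011-p09's `TwistedKummer.exists_sha_ne_zero_of_congr_of_places₆` (p311741): (i) `v ∤ 3`
with `E′(ℚ_v)[3] = 0`; (ii) both split multiplicative with `#E(ℚ_v)[3] ≤ 3`; (iii) both multiplicative,
same twist class, `μ₃(ℚ_v) = 1`; (iv′) `E` non-split multiplicative facing good, `v ∤ 3`; (vi) `E`
good facing non-split multiplicative, `v ∤ 3`; (iii′) `|j(E)|_v > 1`, `|j(E′)|_v > 1`, same twist class,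
`μ₃(ℚ_v) = 1` — the kind of the place `3` itself on r1's road PASS-T (both curves additive potentially
multiplicative at `3`; `μ₃(ℚ₃) = 1`; an add-pm-at-`3` row IS an (M) row, `ord₃ j < 0`).  `T = ∅` (NO paid
place; budget `1 < 3^{rank E′}`).  `E(ℚ)` finite and `3 ∤ #E(ℚ)` are discharged inside (`hGZK`, `hr`,
surj(3)).  `hU` / `hU2` = the REGISTERED printed facts A40 / A41 (Silverman *ATAEC* V.5.3 / V.5.4, Tate
uniformisation), displayed beyond the (M)-END's seven facts; no new fact.  A record over this socket closes
NOTHING beyond its displayed binders (θ, rank E′, `r_an`, `#Ш_an` stay EVIDENCE columns); closes no class.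
[cite: CremonaMazur2000, §3 and Table 1] [cite: AgasheStein2002, Thm. 3.1 and §3.5]
[cite: SilvermanATAEC1994, Ch. V Lemma 5.2 (c), Thm. 5.3, Cor. 5.4] [cite: Delbourgo1998, Prop. 4 (p. 144)] -/
theorem X4RankZero.bsdp_three_potMult_of_congr_of_places₆_of_primeList
    (hKatoS : Kato2004.rankZero_padicValNat_sha_le_sub_localTamagawa_of_additive_potGood_of_imageContainsSL2)
    (hDel : Delbourgo1998.prop4_rankZero_pow_dvd_constantCoeff)
    (hGZK : rank_eq_analyticRank_of_analyticRank_le_one) (hmod : hasEntireLFunction_rat)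
    (hmodD : nonempty_modularParametrizationData)
    (hKatoχ : Wuthrich2014.kato_halfEigenCharIdeal_dvd_cyclotomicPrime_of_surjective)
    (hCT : exists_casselsTate_pairing (K := ℚ))
    (hU : Silverman1994_thmV53_tateUniformisation.{0})
    (hU2 : Silverman1994_thmV53_corV54_tateUniformisation.{0})
    (W : WeierstrassCurve ℚ) [W.IsElliptic] [W.IsGloballyMinimal] (hr : W.analyticRank = 0)
    (hX : haveI : Fact (Nat.Prime 3) := ⟨Nat.prime_three⟩; ClassX4 W 3)
    (hsurj : W.HasSurjectiveModNGaloisRep 3) (hj : padicValRat 3 W.j < 0)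
    {q : ℚ} (hq : shaAn W = (q : ℂ)) (hv : padicValRat 3 q ≤ 2)
    (W' : WeierstrassCurve ℚ) [W'.IsElliptic]
    (θ : geomTorsion W' ((3 : ℕ) : ℤ) ≃+ geomTorsion W ((3 : ℕ) : ℤ))
    (hθ : ∀ (σ : Field.absoluteGaloisGroup ℚ) (P : geomTorsion W' ((3 : ℕ) : ℤ)),
      θ (σ • P) = σ • θ P)
    (hrank : 1 ≤ W'.mordellWeilRank)
    {E₀ F₀ : WeierstrassCurve ℤ} (hE : E₀.map (Int.castRingHom ℚ) = W)
    (hF : F₀.map (Int.castRingHom ℚ) = W') (L : List ℕ) (h3L : 3 ∈ L)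
    (hΔE : ∀ q : ℕ, q.Prime → (q : ℤ) ∣ E₀.Δ → q ∈ L)
    (hΔF : ∀ q : ℕ, q.Prime → (q : ℤ) ∣ F₀.Δ → q ∈ L)
    (hplaces : ∀ w : HeightOneSpectrum (𝓞 ℚ), (primesEquiv w : ℕ) ∈ L →
      ((((3 : ℕ) : 𝓞 ℚ) ∉ w.asIdeal ∧ Nat.card (nsmulAddMonoidHom 3 :
          (W'.baseChange (w.adicCompletion ℚ)).toAffine.Point →+ _).ker = 1) ∨
      (W.HasSplitMultiplicativeReductionAt w ∧ W'.HasSplitMultiplicativeReductionAt w ∧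
        Nat.card (nsmulAddMonoidHom 3 :
          (W.baseChange (w.adicCompletion ℚ)).toAffine.Point →+ _).ker ≤ 3) ∨
      (W.HasMultiplicativeReductionAt w ∧ W'.HasMultiplicativeReductionAt w ∧
        (∃ r : w.adicCompletion ℚ, algebraMap ℚ (w.adicCompletion ℚ) (-(W.c₄ / W.c₆)) =
          r ^ 2 * algebraMap ℚ (w.adicCompletion ℚ) (-(W'.c₄ / W'.c₆))) ∧
        (∀ ζ : w.adicCompletion ℚ, ζ ^ 3 = 1 → ζ = 1)) ∨
      (W.HasMultiplicativeReductionAt w ∧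
        ¬ IsSquare (algebraMap ℚ (w.adicCompletion ℚ) (-(W.c₄ / W.c₆))) ∧
        W'.HasGoodReductionAt w ∧ ((3 : ℕ) : 𝓞 ℚ) ∉ w.asIdeal) ∨
      (W.HasGoodReductionAt w ∧ W'.HasMultiplicativeReductionAt w ∧
        ¬ IsSquare (algebraMap ℚ (w.adicCompletion ℚ) (-(W'.c₄ / W'.c₆))) ∧
        ((3 : ℕ) : 𝓞 ℚ) ∉ w.asIdeal) ∨
      (1 < w.valuation ℚ W.j ∧ 1 < w.valuation ℚ W'.j ∧
        (∃ r : w.adicCompletion ℚ, algebraMap ℚ (w.adicCompletion ℚ) (-(W.c₄ / W.c₆)) =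
          r ^ 2 * algebraMap ℚ (w.adicCompletion ℚ) (-(W'.c₄ / W'.c₆))) ∧
        (∀ ζ : w.adicCompletion ℚ, ζ ^ 3 = 1 → ζ = 1)))) :
    haveI : Fact (Nat.Prime 3) := ⟨Nat.prime_three⟩
    BSDp W 3 := by
  haveI : Fact (Nat.Prime 3) := ⟨Nat.prime_three⟩
  haveI hfinpt : Finite W.toAffine.Point := finite_point_of_analyticRank_eq_zero W hGZK hr
  have hirr : Irr W 3 := hasIrreducibleModPGaloisRep_of_hasSurjectiveModNGaloisRep W 3 hsurj
  obtain ⟨S, hS⟩ := exists_placeFinset_of_primeList L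
  refine X4RankZero.bsdp_three_potMult_of_exists_sha_three_torsion hKatoS hDel hGZK hmod hmodD hKatoχ
    hCT W hr hX hsurj hj hq hv ?_
  refine TwistedKummer.exists_sha_ne_zero_of_congr_of_places₆ W hU hU2 (by norm_num) W' θ hθ S ∅
    (Finset.empty_subset S)
    (good_and_not_mem_of_not_mem_placeFinset hE hF L Nat.prime_three h3L hΔE hΔF hS) hfinpt
    (coprime_natCard_point_of_irr W 3 hirr) ?_ (fun w hw _ ↦ hplaces w ((hS w).mp hw))
  rw [Finset.prod_empty]
  exact Nat.one_lt_pow (by omega) (by norm_num)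

end Summit.BirchSwinnertonDyer.Rank1Residual.Additive

end
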